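import Summits.RiemannHypothesis.RiemannHypothesis.Theses.SignCone
import Literature.Analysis.Fourier.BoasKacSmooth

/-!
# The sign-cone crux and target reduce to SINGLE autocorrelations (`k = 1`)
(route `SignCone`, items stmt-RiemannHypothesis-16302 `SignConeOscillatory` and 16301 `SignConeInequality`)

Both items quantify over finite families `g : Fin k → C_c^∞[-a, a]` and the kernel
`F = Σᵢ gᵢ ⋆ g̃ᵢ`.  By the Boas–Kac factorisation for smooth data
(`Literature.Analysis.Fourier.BoasKac.exists_smooth_autocorr_eq_sum`: a finite sum of autocorrelations of
`C_c^∞` functions with `tsupport ⊆ [-a, a]` is ONE such autocorrelation `f ⋆ f̃`), every such `F` is already of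
the form `f ⋆ f̃` with `f ∈ C_c^∞`, `tsupport f ⊆ [-a, a]`.  Hence each item is EQUIVALENT to its `k = 1`
instance (`signConeOscillatory_iff_single`, `signConeInequality_iff_single`): the sign cone at cutoff `a` is
exactly `{g ⋆ g̃ : g ∈ C_c^∞[-a, a], g ⋆ g̃ node-nonnegative}`, a convex cone although it is written without sums.
For provers, refuters and the numerics seats this removes the family index from the crux: witnesses and
extremal configurations may be sought among single test functions `g` without loss.

This is support for stmt-RiemannHypothesis-16302 (and lemma (1), "Akhiezer–Kreĭn / Boas–Kac factorisation in
the closed cone", of the registered stub `stub_extremalExists` of line `dual_witness`).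
-/

noncomputable section

-- `Summit.RiemannHypothesis.RiemannHypothesis.…` repeats a namespace component by design (D-0017 layout).
set_option linter.dupNamespace false

open scoped BigOperators ComplexConjugate ContDiff
open MeasureTheory Set

namespace Summit.RiemannHypothesis.RiemannHypothesis.Theorems.SignCone

open Summit.RiemannHypothesis.RiemannHypothesis.Theses.SignCone
open Literature.Analysis.Fourier.BoasKac

/-- **`SignConeOscillatory` is equivalent to its single-test-function (`k = 1`) instance.**  The right-hand
side is the crux verbatim with the family `g : Fin k → ℝ → ℂ` replaced by one `g : ℝ → ℂ` and
`F = g ⋆ g̃`; `←` is the Boas–Kac factorisation of `Σᵢ gᵢ ⋆ g̃ᵢ`, `→` is the instance `k = 1`. [folklore] -/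
theorem signConeOscillatory_iff_single : SignConeOscillatory ↔ ∀ a : ℝ, 0 < a → ∀ g : ℝ → ℂ, (ContDiff ℝ ((⊤ : ℕ∞) : WithTop ℕ∞) g ∧ HasCompactSupport g) ∧ tsupport g ⊆ Set.Icc (-a) a → let F : ℝ → ℂ := fun t => MeasureTheory.convolution g (fun u => (starRingEnd ℂ) (g (-u))) (ContinuousLinearMap.mul ℂ ℂ) MeasureTheory.MeasureSpace.volume t; (∀ n : ℕ, 2 ≤ n → 0 ≤ (F (Real.log n)).re) → (∃ t : ℝ, Real.log 2 ≤ |t| ∧ (F t).re < 0) → let M : ℂ → ℂ := fun s => ∫ u : ℝ, F u * Complex.exp ((s - 1 / 2) * u); -(F 0).re ≤ (M 0 + M 1 + ((1 / (2 * Real.pi) : ℂ) * (∫ t : ℝ, M (1 / 2 + t * Complex.I) * ((Complex.digamma (1 / 4 + t / 2 * Complex.I)).re : ℂ)) - F 0 * (Real.log Real.pi : ℂ))).re := by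
  constructor
  · intro h a ha g hg
    have h1 := h a ha 1 (fun _ => g) (fun _ => hg)
    simp only [Fin.sum_univ_one] at h1
    exact h1
  · intro h a ha k g hg F hn hosc M
    obtain ⟨f, hf, hfc, hfs, heq⟩ :=
      exists_smooth_autocorr_eq_sum ha g (fun i => (hg i).1.1) (fun i => (hg i).1.2) fun i => (hg i).2
    have h1 := h a ha f ⟨⟨hf, hfc⟩, hfs⟩
    simp only [heq] at h1
    exact h1 hn hosc

/-- **`SignConeInequality` (the route target) is equivalent to its single-test-function instance**, for the
same reason. [folklore] -/
theorem signConeInequality_iff_single :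
    SignConeInequality ↔
      ∀ a : ℝ, 0 < a → ∀ g : ℝ → ℂ,
        (ContDiff ℝ ((⊤ : ℕ∞) : WithTop ℕ∞) g ∧ HasCompactSupport g) ∧ tsupport g ⊆ Set.Icc (-a) a →
        let F : ℝ → ℂ := fun t => MeasureTheory.convolution g (fun u => (starRingEnd ℂ) (g (-u)))
          (ContinuousLinearMap.mul ℂ ℂ) MeasureTheory.MeasureSpace.volume t;
        (∀ n : ℕ, 2 ≤ n → 0 ≤ (F (Real.log n)).re) →
        let M : ℂ → ℂ := fun s => ∫ u : ℝ, F u * Complex.exp ((s - 1 / 2) * u);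
        -(F 0).re ≤ (M 0 + M 1 + ((1 / (2 * Real.pi) : ℂ) *
          (∫ t : ℝ, M (1 / 2 + t * Complex.I) * ((Complex.digamma (1 / 4 + t / 2 * Complex.I)).re : ℂ)) -
            F 0 * (Real.log Real.pi : ℂ))).re := by
  constructor
  · intro h a ha g hg
    have h1 := h a ha 1 (fun _ => g) (fun _ => hg)
    simp only [Fin.sum_univ_one] at h1
    exact h1
  · intro h a ha k g hg F hn M
    obtain ⟨f, hf, hfc, hfs, heq⟩ :=
      exists_smooth_autocorr_eq_sum ha g (fun i => (hg i).1.1) (fun i => (hg i).1.2) fun i => (hg i).2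
    have h1 := h a ha f ⟨⟨hf, hfc⟩, hfs⟩
    simp only [heq] at h1
    exact h1 hn

/-- **The sign cone needs no sums.**  At every cutoff, every kernel `Σᵢ gᵢ ⋆ g̃ᵢ` of the route's cone
(`gᵢ ∈ C_c^∞`, `tsupport gᵢ ⊆ [-a, a]`) is a single `f ⋆ f̃` of the same kind — the route-level reading of the
Boas–Kac factorisation. [folklore] -/
theorem signCone_kernel_eq_single_autocorr {a : ℝ} (ha : 0 < a) {k : ℕ} (g : Fin k → ℝ → ℂ)
    (hg : ∀ i, (ContDiff ℝ ((⊤ : ℕ∞) : WithTop ℕ∞) (g i) ∧ HasCompactSupport (g i)) ∧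
      tsupport (g i) ⊆ Set.Icc (-a) a) :
    ∃ f : ℝ → ℂ, (ContDiff ℝ ((⊤ : ℕ∞) : WithTop ℕ∞) f ∧ HasCompactSupport f) ∧ tsupport f ⊆ Set.Icc (-a) a ∧
      (fun t => ∑ i, MeasureTheory.convolution (g i) (fun u => (starRingEnd ℂ) ((g i) (-u)))
        (ContinuousLinearMap.mul ℂ ℂ) MeasureTheory.MeasureSpace.volume t) =
      MeasureTheory.convolution f (fun u => (starRingEnd ℂ) (f (-u))) (ContinuousLinearMap.mul ℂ ℂ)
        MeasureTheory.MeasureSpace.volume := by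
  obtain ⟨f, hf, hfc, hfs, heq⟩ :=
    exists_smooth_autocorr_eq_sum ha g (fun i => (hg i).1.1) (fun i => (hg i).1.2) fun i => (hg i).2
  exact ⟨f, ⟨hf, hfc⟩, hfs, heq.symm⟩

end Summit.RiemannHypothesis.RiemannHypothesis.Theorems.SignCone

end
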